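import Summits.BirchSwinnertonDyer.Uniform.UI.O6WildThreePart
import Literature.NumberTheory.EllipticCurves.BSDRankZeroDensityProofs
import HarnessLib
import HarnessLib.Audit.Tags

/-!
# UI-O6 — the KERNEL READING of a `3`-descent record on a content row of pocket O6

Cell `bsd-uniform`, seat `ui-o6` (GEN 2, prover `prover-bsd-uniform-ui-o6-g2-0`); companion note
`pub/bsd-uniform/ui/O6-CONJECTURE.md` §4.6b (evidence item E-CORE: the b2b cell's two-engine EXACT
`3`-descent SEL3CT@3 on held-out rank-`0` O6 rows with `9 ∣ #Ш_an`; kit `j254730`, `j254797`).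

HONEST FRAMING. THEOREMS ONLY (no `def`, no named fact, no `sorry`; axioms standard). This file
proves NOTHING about any particular curve and nothing uniform about pocket O6: it states, once, in
the kernel, what ONE per-pair `3`-descent record means for the left conjunct of the seat's typed
conjecture `Summit.BirchSwinnertonDyer.Uniform.UI.O6WildThreePart` — in both directions of the
pre-registered read/kill rule — with the record's values as EXPLICIT BINDERS
(`Nat.card (W.selmerGroup 3) = 3 ^ 2`, `Nat.card E(ℚ)[3] = 1`, `#Ш_an = q` with `ord₃ q ≤ 2`),
exactly as the b2b lane reads its SEL3CT records (`hcard` binders). A record instantiating the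
binders is PER-PAIR EVIDENCE, never a uniform theorem; nothing is booked here; no census mark
moves; Gross–Zagier–Kolyvagin enters as the tree's named fact `hGZK` (bsd.S17) where finiteness of
`Ш` or `rank = 0` is needed, so those theorems are CONDITIONAL on it, as everywhere in the lane.

CONTENTS.
* `natCard_selmerGroup_three_eq` — `#Sel₃ = 3^{rank} · #E(ℚ)[3] · #Ш[3]` (tree's descent count at `n = 3`).
* `natCard_sha_torsionBy_three_eq_nine_of_record` — `rank E(ℚ) = 0`, `#E(ℚ)[3] = 1`,
  `#Sel₃(E/ℚ) = 9` ⇒ `#Ш(E/ℚ)[3] = 9` (the descent count `#Sel_n = n^r · #E(ℚ)[n] · #Ш[n]`,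
  Silverman AEC X.4.2, tree `natCard_selmerGroup_eq`).
* `pow_two_dvd_shaOrder_of_record` — hence `3² ∣ #Ш(E/ℚ)` (Lagrange; `#Ш := Nat.card`).
* `missingLowerBoundAt_three_of_record` — **the positive reading**: with `hGZK` at analytic rank `0`
  and `#Ш_an = q`, `ord₃ q ≤ 2`, the record gives `MissingLowerBoundAt W 3`
  (`ord₃ #Ш_an ≤ ord₃ #Ш`) — the INSTANCE at `W` of the left conjunct of `O6WildThreePart`.
* `missingPPartAt_three_of_record_of_upper` — with the upper half (Kato 14.5 (3) where it applies)
  the record pins the full `3`-part output `MissingPPartAt W 3` at the pair.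
* `not_missingLowerBoundAt_three_of_selmer_trivial` — **the kill reading**: `Ш` finite,
  `#Sel₃(E/ℚ) = 1` and `ord₃ #Ш_an > 0` ⇒ `¬ MissingLowerBoundAt W 3`.
* `not_o6WildThreePart_of_kill_record` — so ONE such record on a globally minimal O6 curve of
  analytic rank `0` would REFUTE the conjecture (the registered KILL RULE of PREREG-ECORE, in the
  kernel). No such record exists: E-CORE returned `#Sel₃ = 9` on 25/25 computable content rows.
-/

noncomputable section

open scoped Classical AddSubgroup

open WeierstrassCurve Literature.NumberTheory.EllipticCurves
  Literature.NumberTheory.EllipticCurves.Rank1Residual.Typed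
  Literature.Algebra.Module

namespace Summit.BirchSwinnertonDyer.Uniform.UI

open Summit.BirchSwinnertonDyer.Rank1Residual.Additive

variable (W : WeierstrassCurve ℚ) [W.IsElliptic]

/-- **`#Sel₃(E/ℚ) = 3^{rank E(ℚ)} · #E(ℚ)[3] · #Ш(E/ℚ)[3]`** — the tree's descent count
`natCard_selmerGroup_eq` (Silverman AEC X.4.2) at `n = 3`, with the factor `#(Ш ⊓ H¹(ℚ,E)[3])`
rewritten as the order of the `3`-torsion subgroup of `Ш` (as `Uniform/U2/SelmerControlKernel` does
at `n = 2`). [cite: SilvermanAEC2009, Thm. X.4.2] -/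
theorem natCard_selmerGroup_three_eq :
    Nat.card (W.selmerGroup 3) =
      3 ^ W.mordellWeilRank * Nat.card (W.toAffine.Point[(3 : ℤ)]) *
        Nat.card ((W.sha)[(3 : ℤ)]) := by
  have h := W.natCard_selmerGroup_eq (n := 3) (by norm_num)
  simp only [Nat.cast_ofNat] at h
  rw [natCard_torsionBy_addSubgroup W.sha (3 : ℤ)]
  convert h

/-- **Descent count at `3`, record form.** If `rank E(ℚ) = 0`, `E(ℚ)[3] = 0` (as `#E(ℚ)[3] = 1`)
and `#Sel^{(3)}(E/ℚ) = 9`, then `#Ш(E/ℚ)[3] = 9`. [cite: SilvermanAEC2009, Thm. X.4.2] -/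
theorem natCard_sha_torsionBy_three_eq_nine_of_record (hrank : W.mordellWeilRank = 0)
    (htors : Nat.card (W.toAffine.Point[(3 : ℤ)]) = 1)
    (hsel : Nat.card (W.selmerGroup 3) = 3 ^ 2) :
    Nat.card ((W.sha)[(3 : ℤ)]) = 3 ^ 2 := by
  have h := natCard_selmerGroup_three_eq W
  rw [hrank, pow_zero, htors, one_mul, one_mul, hsel] at h
  exact h.symm

/-- **`3² ∣ #Ш(E/ℚ)` from the record** (Lagrange applied to `Ш[3] ≤ Ш`; `#Ш := Nat.card`, so no
finiteness hypothesis is needed for the divisibility itself). [cite: SilvermanAEC2009, Thm. X.4.2] -/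
theorem pow_two_dvd_shaOrder_of_record (hrank : W.mordellWeilRank = 0)
    (htors : Nat.card (W.toAffine.Point[(3 : ℤ)]) = 1)
    (hsel : Nat.card (W.selmerGroup 3) = 3 ^ 2) : 3 ^ 2 ∣ W.shaOrder := by
  rw [WeierstrassCurve.shaOrder, ← natCard_sha_torsionBy_three_eq_nine_of_record W hrank htors hsel]
  exact AddSubgroup.card_addSubgroup_dvd_card _

/-- **The positive reading of an E-CORE record (PREREG-ECORE C1, kernel form).** Granted
Gross–Zagier–Kolyvagin (`hGZK` = bsd.S17: at analytic rank `0`, `rank E(ℚ) = 0` and `Ш(E/ℚ)` is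
finite), a `3`-descent record `#Sel^{(3)}(E/ℚ) = 9` with `E(ℚ)[3] = 0` on a curve whose analytic
order of `Ш` is a rational `q` with `ord₃ q ≤ 2` delivers `MissingLowerBoundAt W 3`
(`ord₃ #Ш_an ≤ ord₃ #Ш`): `3² ∣ #Ш ≠ 0 ⇒ 2 ≤ ord₃ #Ш`. This is the INSTANCE at `W` of the left
conjunct of `O6WildThreePart` when `W` is an O6 curve — per-pair evidence, not the conjunct.
[cite: SilvermanAEC2009, Thm. X.4.2] [cite: Miller2011LMS, Def. 1.1 (arXiv:1010.2431 p. 3)] -/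
theorem missingLowerBoundAt_three_of_record
    (hGZK : rank_eq_analyticRank_of_analyticRank_le_one) (hr : W.analyticRank = 0)
    (htors : Nat.card (W.toAffine.Point[(3 : ℤ)]) = 1)
    (hsel : Nat.card (W.selmerGroup 3) = 3 ^ 2) {q : ℚ} (hq : shaAn W = (q : ℂ))
    (hv : padicValRat 3 q ≤ 2) : MissingLowerBoundAt W 3 := by
  haveI : Fact (3 : ℕ).Prime := ⟨Nat.prime_three⟩
  obtain ⟨hrank, hfin⟩ := hGZK W (by omega)
  rw [hr] at hrank
  have hdvd := pow_two_dvd_shaOrder_of_record W hrank htors hsel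
  have hn : W.shaOrder ≠ 0 := (WeierstrassCurve.shaOrder_pos W hfin).ne'
  have hle : 2 ≤ padicValNat 3 W.shaOrder := (padicValNat_dvd_iff_le hn).1 hdvd
  refine ⟨q, hq, hv.trans ?_⟩
  exact_mod_cast hle

/-- **Record + upper half ⇒ the full `3`-part output at the pair.** Where the UPPER half
`ord₃ #Ш ≤ ord₃ #Ш_an` is available (in print: Kato, Astérisque 295, Thm. 14.5 (3) under (12.5.2);
in the b2b kernel `X4RankZero.missingUpperBoundAt_of_kato` under its explicit hypotheses), the
record pins `MissingPPartAt W 3` (`ord₃ #Ш = ord₃ #Ш_an`) — the per-pair BSD₃ currency of the lane.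
Bookkeeping; nothing booked here. [cite: Kato2004Asterisque, Thm. 14.5 (3) (pp. 236–237)]
[cite: Miller2011LMS, Def. 1.1] -/
theorem missingPPartAt_three_of_record_of_upper
    (hGZK : rank_eq_analyticRank_of_analyticRank_le_one) (hr : W.analyticRank = 0)
    (htors : Nat.card (W.toAffine.Point[(3 : ℤ)]) = 1)
    (hsel : Nat.card (W.selmerGroup 3) = 3 ^ 2) {q : ℚ} (hq : shaAn W = (q : ℂ))
    (hv : padicValRat 3 q ≤ 2) (hup : MissingUpperBoundAt W 3) : MissingPPartAt W 3 :=
  missingPPartAt_of_lower_of_upper W 3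
    (missingLowerBoundAt_three_of_record W hGZK hr htors hsel hq hv) hup

/-- **The kill reading (PREREG-ECORE kill rule, kernel form).** If `Ш(E/ℚ)` is finite,
`#Sel^{(3)}(E/ℚ) = 1` and the analytic order of `Ш` is a rational `q` with `ord₃ q > 0`, then the
lower half FAILS at `(E, 3)`: `#Sel₃ = 1` forces `Ш[3] = 0` (descent count), hence `3 ∤ #Ш` (Cauchy),
so `ord₃ #Ш = 0 < ord₃ #Ш_an`. [cite: SilvermanAEC2009, Thm. X.4.2] [cite: Miller2011LMS, Def. 1.1] -/
theorem not_missingLowerBoundAt_three_of_selmer_trivial (hfin : W.ShaFinite)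
    (hsel : Nat.card (W.selmerGroup 3) = 1) {q : ℚ} (hq : shaAn W = (q : ℂ))
    (hv : 0 < padicValRat 3 q) : ¬ MissingLowerBoundAt W 3 := by
  haveI : Fact (3 : ℕ).Prime := ⟨Nat.prime_three⟩
  haveI : Finite W.sha := hfin
  -- descent count: `1 = 3^r · #E(ℚ)[3] · #Ш[3]`, so the last factor is `1`
  have hcount := (natCard_selmerGroup_three_eq W).symm.trans hsel
  have hsha3 : Nat.card ((W.sha)[(3 : ℤ)]) = 1 := Nat.eq_one_of_mul_eq_one_left hcount
  -- hence `3 ∤ #Ш`: an element of order `3` would be a second element of `Ш[3]`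
  have hndvd : ¬ 3 ∣ W.shaOrder := by
    intro hdvd
    rw [WeierstrassCurve.shaOrder] at hdvd
    obtain ⟨x, hx⟩ := exists_prime_addOrderOf_dvd_card' (G := W.sha) 3 hdvd
    have hx3 : (3 : ℤ) • x = 0 := by
      have h3 := addOrderOf_nsmul_eq_zero x
      rw [hx] at h3
      exact_mod_cast h3
    have hx0 : x ≠ 0 := by
      intro h0
      rw [h0, addOrderOf_zero] at hx
      norm_num at hx
    have hmem : x ∈ (W.sha)[(3 : ℤ)] := (Submodule.mem_torsionBy_iff _ _).mpr hx3
    haveI : Subsingleton ((W.sha)[(3 : ℤ)]) :=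
      (Nat.card_eq_one_iff_unique.mp hsha3).1
    have h01 : (⟨x, hmem⟩ : (W.sha)[(3 : ℤ)]) = ⟨0, AddSubgroup.zero_mem _⟩ := Subsingleton.elim _ _
    exact hx0 (Subtype.ext_iff.mp h01)
  have hval : padicValNat 3 W.shaOrder = 0 := padicValNat.eq_zero_of_not_dvd hndvd
  rintro ⟨q', hq', hle⟩
  have hqq : q' = q := by exact_mod_cast hq'.symm.trans hq
  subst hqq
  rw [hval] at hle
  exact absurd (lt_of_lt_of_le hv hle) (lt_irrefl _)

/-- **What ONE kill record would have meant for the conjecture.** A globally minimal elliptic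
`W/ℚ` of analytic rank `0` in pocket O6 (`ClassO6 W 3`) carrying a record `#Sel^{(3)}(W/ℚ) = 1`
while `ord₃ #Ш_an(W) > 0` refutes `O6WildThreePart` (its left conjunct at `W`; finiteness of `Ш`
from `hGZK`). The pre-registered E-CORE runs (kit `j254730`, `j254797`) found NO such record — this
theorem records the falsifiability of the typed statement, not a refutation.
[cite: Miller2011LMS, Def. 1.1] [cite: Kato2004Asterisque, Conj. 12.10 (p. 224)] -/
theorem not_o6WildThreePart_of_kill_record [W.IsGloballyMinimal]
    (hGZK : rank_eq_analyticRank_of_analyticRank_le_one) (hr : W.analyticRank = 0)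
    (hO6 : ClassO6 W 3) (hsel : Nat.card (W.selmerGroup 3) = 1) {q : ℚ}
    (hq : shaAn W = (q : ℂ)) (hv : 0 < padicValRat 3 q) : ¬ O6WildThreePart := fun h ↦
  not_missingLowerBoundAt_three_of_selmer_trivial W (hGZK W (by omega)).2 hsel hq hv (h.1 W hr hO6)

end Summit.BirchSwinnertonDyer.Uniform.UI
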